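import Mathlib.Analysis.SpecialFunctions.Exp
import Summits.NavierStokesRegularity.FluidComputer.RowPipeline
import HarnessLib

/-!
# The row check, named stages and the generic rounding lemmas
# (`pub-fluidc-bp3/R1-DESIGN.md` §9.4, layer B of `structure Row` — soundness scaffolding)

HONEST FRAMING (cell `pub-fluidc`, blueprint seat bp3, gen 20): low prior, high value-of-information
experiment on Tao's machine paradigm; NOT a claim that NS blows up. Integer / real bookkeeping only.

`RowPipeline.rowCheck` is one monolithic `let` cascade (so that evaluation shares every table, as
the kernel does). For the soundness proofs this file (1) proves the generic facts about the
tabulation and rounding primitives — `Tab.at_mk'`, `Vec.get_mk'`, `sumZ = Σ`, `maxZ` bounds,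
`mmUp`/`mvUp` round the real matrix products UP (`Σ_j (A_ij/2^P)(B_jk/2^P) ≤ mmUp_ik/2^P`), the
commuting form of the iterations (`squarings (n+1) = step ∘ squarings n`, `blocks (n+1) = step ∘
blocks n`, `blocks (m+d) = blocks d ∘ blocks m`, the sup only grows) — and (2) names every stage of
`rowCheck` as its own definition on `RowData` (`ph'`, `sb'`, `c'`, `B'`, `phi'`, `hInt'`, `eta'`,
`etap'`, `g'`, `Et`, `Eg'`, `Adec0`, `bdec0`, `dec n`, `nd n`, `us n`) with
`rowCheck_eq : r.rowCheck = ⟨…stages…⟩` by `rfl`, so that `Cert` fields can be stated against named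
integer tables (`RowScaleSound`, `RowChainSound`).

[cite: Tao2016AveragedNS, §5.5 Thm 5.3 (5.5)]
-/

namespace Summit.NavierStokesRegularity.FluidComputer

open Literature.Analysis.FluidPDE.FluidComputer
open Literature.Analysis.ValidatedNumerics.Numerics (cdiv div_le_cdiv le_cdiv_mul_real)

namespace RowCheck

open DIVec ChainField Finset

/-! ### Generic facts -/

/-- Tabulation is transparent. [folklore] -/
@[simp] theorem Tab.at_mk' {α : Type} {n m : ℕ} (f : Fin n → Fin m → α) (i : Fin n) (j : Fin m) :
    (Tab.mk' f).at i j = f i j := by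
  simp [Tab.mk', Tab.at]

/-- Tabulation is transparent. [folklore] -/
@[simp] theorem Vec.get_mk' {α : Type} {n : ℕ} (f : Fin n → α) (i : Fin n) :
    (Vec.mk' f).get i = f i := by
  simp [Vec.mk']

/-- `sumZ` is the `Finset` sum. [folklore] -/
theorem sumZ_eq (n : ℕ) (f : Fin n → ℤ) : sumZ n f = ∑ i, f i := by
  induction n with
  | zero => simp [sumZ]
  | succ n ih => rw [sumZ, ih, Fin.sum_univ_castSucc]

/-- The floor is below `maxZ`. [folklore] -/
theorem le_maxZ (n : ℕ) (b : ℤ) (f : Fin n → ℤ) : b ≤ maxZ n b f := by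
  induction n with
  | zero => simp [maxZ]
  | succ n ih => exact (ih (fun i => f (Fin.castSucc i))).trans (le_max_left _ _)

/-- Every value is below `maxZ`. [folklore] -/
theorem apply_le_maxZ (n : ℕ) (b : ℤ) (f : Fin n → ℤ) (i : Fin n) : f i ≤ maxZ n b f := by
  induction n with
  | zero => exact i.elim0
  | succ n ih =>
    rw [maxZ]
    rcases Fin.eq_castSucc_or_eq_last i with ⟨j, rfl⟩ | rfl
    · exact (ih (fun i => f (Fin.castSucc i)) j).trans (le_max_left _ _)
    · exact le_max_right _ _

/-- `2^P > 0` as an integer. [folklore] -/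
theorem one_pos (P : ℕ) : 0 < one P := by unfold one; positivity

/-- `2^P` cast. [folklore] -/
@[simp] theorem cast_one (P : ℕ) : ((one P : ℤ) : ℝ) = 2 ^ P := by simp [one]

/-- Rounded-up division bounds the real quotient: `a / 2^P ≤ cdiv a (2^P)`. [folklore] -/
theorem div_le_cdiv_one (P : ℕ) (a : ℤ) : (a : ℝ) / 2 ^ P ≤ ((cdiv a (one P) : ℤ) : ℝ) := by
  have h := div_le_cdiv (a := a) (one_pos P)
  simpa using h

/-- `mmUp` rounds the real matrix product up. [folklore] -/
theorem mmUp_ge (P : ℕ) {n : ℕ} (A B : Tab ℤ n n) (i k : Fin n) :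
    ∑ j, ((A.at i j : ℝ) / 2 ^ P) * ((B.at j k : ℝ) / 2 ^ P) ≤
      ((mmUp P A B).at i k : ℝ) / 2 ^ P := by
  rw [mmUp, Tab.at_mk', sumZ_eq]
  have h := div_le_cdiv_one P (∑ j, A.at i j * B.at j k)
  push_cast at h
  have h2 : ∑ j, ((A.at i j : ℝ) / 2 ^ P) * ((B.at j k : ℝ) / 2 ^ P) =
      (∑ j, (A.at i j : ℝ) * (B.at j k : ℝ)) / 2 ^ P / 2 ^ P := by
    rw [Finset.sum_div, Finset.sum_div]
    refine Finset.sum_congr rfl fun j _ => ?_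
    ring
  rw [h2]
  exact div_le_div_of_nonneg_right h (by positivity)

/-- `mvUp` rounds the real matrix-vector product up. [folklore] -/
theorem mvUp_ge (P : ℕ) {n : ℕ} (A : Tab ℤ n n) (v : Vec ℤ n) (i : Fin n) :
    ∑ j, ((A.at i j : ℝ) / 2 ^ P) * ((v.get j : ℝ) / 2 ^ P) ≤
      (((mvUp P A v).get i : ℤ) : ℝ) / 2 ^ P := by
  rw [mvUp, Vec.get_mk', sumZ_eq]
  have h := div_le_cdiv_one P (∑ j, A.at i j * v.get j)
  push_cast at h
  have h2 : ∑ j, ((A.at i j : ℝ) / 2 ^ P) * ((v.get j : ℝ) / 2 ^ P) =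
      (∑ j, (A.at i j : ℝ) * (v.get j : ℝ)) / 2 ^ P / 2 ^ P := by
    rw [Finset.sum_div, Finset.sum_div]
    refine Finset.sum_congr rfl fun j _ => ?_
    ring
  rw [h2]
  exact div_le_div_of_nonneg_right h (by positivity)

/-- One squaring step. [folklore] -/
def sqStep (P : ℕ) (Ab : Tab ℤ 8 8 × Vec ℤ 8) : Tab ℤ 8 8 × Vec ℤ 8 :=
  (mmUp P Ab.1 Ab.1, Vec.mk' fun i => (mvUp P Ab.1 Ab.2).get i + Ab.2.get i)

/-- `squarings (n+1) = sqStep ∘ squarings n`. [folklore] -/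
theorem squarings_succ (P : ℕ) (n : ℕ) (Ab : Tab ℤ 8 8 × Vec ℤ 8) :
    RowData.squarings P (n + 1) Ab = sqStep P (RowData.squarings P n Ab) := by
  induction n generalizing Ab with
  | zero => rfl
  | succ n ih => exact ih _

/-- One block step. [folklore] -/
def blStep (P : ℕ) (And : Tab ℤ 8 8) (bnd : Vec ℤ 8) (Adc : Tab ℤ 8 8) (bdc : Vec ℤ 8)
    (us : Vec ℤ 8 × Vec ℤ 8) : Vec ℤ 8 × Vec ℤ 8 :=
  (Vec.mk' fun i => (mvUp P Adc us.1).get i + bdc.get i,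
   Vec.mk' fun i => max (us.2.get i) ((mvUp P And us.1).get i + bnd.get i))

/-- `blocks (n+1) = blStep ∘ blocks n`. [folklore] -/
theorem blocks_succ (P : ℕ) (And : Tab ℤ 8 8) (bnd : Vec ℤ 8) (Adc : Tab ℤ 8 8) (bdc : Vec ℤ 8)
    (n : ℕ) (us : Vec ℤ 8 × Vec ℤ 8) :
    RowData.blocks P And bnd Adc bdc (n + 1) us =
      blStep P And bnd Adc bdc (RowData.blocks P And bnd Adc bdc n us) := by
  induction n generalizing us with
  | zero => rfl
  | succ n ih => exact ih _

/-- `blocks (m + d) = blocks d ∘ blocks m`. [folklore] -/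
theorem blocks_add (P : ℕ) (And : Tab ℤ 8 8) (bnd : Vec ℤ 8) (Adc : Tab ℤ 8 8) (bdc : Vec ℤ 8)
    (m d : ℕ) (us : Vec ℤ 8 × Vec ℤ 8) :
    RowData.blocks P And bnd Adc bdc (m + d) us =
      RowData.blocks P And bnd Adc bdc d (RowData.blocks P And bnd Adc bdc m us) := by
  induction d with
  | zero => rfl
  | succ d ih => rw [← Nat.add_assoc, blocks_succ, ih, blocks_succ]

/-- The sup component of `blocks` only grows. [folklore] -/
theorem blocks_sup_mono (P : ℕ) (And : Tab ℤ 8 8) (bnd : Vec ℤ 8) (Adc : Tab ℤ 8 8) (bdc : Vec ℤ 8)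
    (n : ℕ) (us : Vec ℤ 8 × Vec ℤ 8) (i : Fin 8) :
    us.2.get i ≤ (RowData.blocks P And bnd Adc bdc n us).2.get i := by
  induction n with
  | zero => exact le_rfl
  | succ n ih => rw [blocks_succ]; exact ih.trans (by simp [blStep])

/-! ### Named stages of `rowCheck` -/

namespace RowData

variable (r : RowData)

/-- Stage: phase step. [folklore] -/
def ph' : Phase := r.phase r.FQ r.DB
/-- Stage: sub-interval accumulation. [folklore] -/
def sb' : Sub := r.subsAcc r.pre r.ph'.rho r.KSUB
/-- Stage: shift `c`. [folklore] -/
def c' : ℤ := max 0 (maxZ 8 0 fun i => -(r.sb'.K.at i i).lo)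
/-- Stage: hull `B`. [folklore] -/
def B' : Tab ℤ 8 8 :=
  Tab.mk' fun i j => ((r.sb'.K.at i j).add (if i = j then ⟨r.c', r.c'⟩ else DI.pt 0)).mag
/-- Stage: forcing `φ`. [folklore] -/
def phi' : Vec ℤ 8 := Vec.mk' fun i => sumZ 9 fun k =>
  cdiv (r.sb'.CF.at i.succ k * r.Eb k) (one r.P) +
    cdiv (cdiv ((one r.P + r.ph'.rho) * r.sb'.APTM.at i.succ k) (one r.P) *
      (r.FQ.get k + r.DEL k + r.DB.get k)) (one r.P)
/-- Stage: `h·2^P` as a rational. [folklore] -/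
def hq' : ℚ := r.Hq / 2 ^ r.S * 2 ^ r.P
/-- Stage: `h·2^P`. [folklore] -/
def hInt' : ℤ := r.hq'.num
/-- Stage: `E` tabulated. [folklore] -/
def Et : Tab ℤ 8 8 := Tab.mk' r.E
/-- Stage: `⌈c h⌉`. [folklore] -/
def ch' : ℤ := cdiv (r.c' * r.hInt') (one r.P)
/-- Stage: `⌊c h⌋`. [folklore] -/
def chlo' : ℤ := (r.c' * r.hInt') / one r.P
/-- Stage: `η`. [folklore] -/
def eta' : ℤ := cdiv (one r.P * one r.P) (one r.P + r.chlo')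
/-- Stage: `η'`. [folklore] -/
def etap' : ℤ := cdiv (one r.P * one r.P) (one r.P - r.ch')
/-- Stage: `g = h η' φ`. [folklore] -/
def g' : Vec ℤ 8 :=
  Vec.mk' fun k => cdiv (r.hInt' * cdiv (r.etap' * r.phi'.get k) (one r.P)) (one r.P)
/-- Stage: `E g`. [folklore] -/
def Eg' : Vec ℤ 8 := mvUp r.P r.Et r.g'
/-- Stage: decayed chain start `η E`. [folklore] -/
def Adec0 : Tab ℤ 8 8 := Tab.mk' fun i k => cdiv (r.eta' * r.Et.at i k) (one r.P)
/-- Stage: decayed chain start `η E g`. [folklore] -/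
def bdec0 : Vec ℤ 8 := Vec.mk' fun i => cdiv (r.eta' * r.Eg'.get i) (one r.P)
/-- Stage: decayed chain after `n` squarings. [folklore] -/
def dec (n : ℕ) : Tab ℤ 8 8 × Vec ℤ 8 := squarings r.P n (r.Adec0, r.bdec0)
/-- Stage: no-decay chain after `n` squarings. [folklore] -/
def nd (n : ℕ) : Tab ℤ 8 8 × Vec ℤ 8 := squarings r.P n (r.Et, r.Eg')
/-- Stage: `(u, u_sup)` after `n` blocks. [folklore] -/
def us (n : ℕ) : Vec ℤ 8 × Vec ℤ 8 :=
  blocks r.P (r.nd (r.S - r.msub)).1 (r.nd (r.S - r.msub)).2 (r.dec (r.S - r.msub)).1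
    (r.dec (r.S - r.msub)).2 n (Vec.mk' fun i => r.u i.succ, Vec.mk' fun _ => 0)

/-- `rowCheck` is the record of the named stages. [folklore] -/
theorem rowCheck_eq : r.rowCheck =
    ⟨r.closOK r.pre, r.ph', r.sb', r.c', r.B', r.phi', r.hInt', decide (r.hq'.den = 1),
     decide (∀ i k : Fin 8, (if i = k then one r.P * one r.P * one r.P else 0) +
       r.hInt' * (sumZ 8 fun j => r.B'.at i j * r.Et.at j k) ≤ r.Et.at i k * one r.P * one r.P),
     decide (r.ch' < one r.P), r.eta', r.etap', (r.us (2 ^ r.msub)).1, (r.us (2 ^ r.msub)).2,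
     decide (∀ i : Fin 8, (r.us (2 ^ r.msub)).2.get i < r.Wbar i.succ)⟩ := rfl

/-- The sign conditions the kernel leaves implicit and `Cert` needs: the proposals `E`, `Ē`, `u`,
the class radii `DEL`, the forcing `φ` and `ρ` are nonnegative and `H > 0` (true of every row the
kernel writes; checked alongside `rowOK`). [folklore] -/
def signsOK : Bool :=
  decide (∀ i k : Fin 8, 0 ≤ r.E i k) && decide (∀ k : Fin 9, 0 ≤ r.Eb k) &&
    decide (∀ i : Fin 8, 0 ≤ r.u i.succ) && decide (∀ k : Fin 9, 0 ≤ r.DEL k) &&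
    decide (∀ i : Fin 8, 0 ≤ r.phi'.get i) && decide (0 ≤ r.ph'.rho) && decide (0 < r.Hq)

/-- A row PASSES: the kernel's conjunction `rowOK` and the sign conditions. [folklore] -/
def rowPass : Bool := r.rowOK && r.signsOK

end RowData

end RowCheck

end Summit.NavierStokesRegularity.FluidComputer
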